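import Summits.AtomisticToContinuum.BoseEinsteinCondensation.Theorems.BECInsertionCorrectorBoundaryTransferWeakFreeOneBodyApproxAux
import Literature.MathematicalPhysics.QuantumManyBody.BoseGasCatStates
import Mathlib.Analysis.Calculus.FDeriv.WithLp

/-!
# Crux `BoundaryTransferWeak` (stmt-AtomisticToContinuum-0827), line `Sketch`
# (idea `coupled-bath-relocation`): stub `stub_freeOneBodyApprox` (S2a)

**Free one-body approximants of the sine mode.** For every `L > 0` and `ε > 0` there is a
one-particle `C¹` Dirichlet trial state `φ` of the box `Λ_L = (0, L)³` with free energy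
`≤ 3(π/L)² + ε` and `‖φ - u_L‖₂² ≤ ε`, where `u_L(x) = ∏ₖ √(2/L) sin(π x_k / L)` is the normalised
Dirichlet ground mode of the box (extended by zero).  The sine mode itself is not admissible (its
zero extension is not `C¹`), hence the approximants: `φ(x) = ∏ₖ g̃_τ(x_k)` with
`g̃_τ = g_τ / ‖g_τ‖₂`, `g_τ(t) = sin(πt/L) S(t/τ) S((L-t)/τ)` (`S = Real.smoothTransition`), whose
energy is `3 ∫g_τ'² / ∫g_τ² → 3(π/L)²` and whose distance to `u_L` is `≤ 9 ∫(g̃_τ - √(2/L) sin)² → 0`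
as `τ → 0`; a good `τ` is extracted from these limits. [folklore]
-/

noncomputable section

namespace Summit.AtomisticToContinuum.BoseEinsteinCondensation.CoupledBaths

open Literature.MathematicalPhysics.QuantumManyBody.BoseGas MeasureTheory Filter Topology Set
open scoped ENNReal NNReal

namespace FreeOneBodyApprox

variable {L τ : ℝ}

/-! ### The product mode on `ℝ³` -/

/-- The product mode `U(x) = ∏ₖ g̃(x_k)`. [folklore] -/
def mode (L τ : ℝ) (x : Space) : ℝ := ∏ k, gn L τ (x k)

/-- `U` is `C¹`. [folklore] -/
theorem contDiff_mode (L τ : ℝ) : ContDiff ℝ 1 (mode L τ) :=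
  contDiff_prod fun k _ =>
    (contDiff_gn L τ).comp (PiLp.proj 2 (𝕜 := ℝ) (fun _ : Fin 3 => ℝ) k).contDiff

/-- `U` vanishes off the open box. [folklore] -/
theorem mode_eq_zero (hτ : 0 < τ) {x : Space} (hx : x ∉ box L) : mode L τ x = 0 := by
  simp only [box, mem_setOf_eq, not_forall] at hx
  obtain ⟨k, hk⟩ := hx
  exact Finset.prod_eq_zero (Finset.mem_univ k) (gn_eq_zero hτ hk)

/-- The one-variable factors of `|∂ₖU|²`: `g̃'²` in the `k`-th variable, `g̃²` in the others.
[folklore] -/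
def dfac (L τ : ℝ) (k j : Fin 3) (t : ℝ) : ℝ≥0∞ :=
  if j = k then ENNReal.ofReal (dgn L τ t ^ 2) else ENNReal.ofReal (gn L τ t ^ 2)

/-- The factors are measurable. [folklore] -/
theorem measurable_dfac (L τ : ℝ) (k j : Fin 3) : Measurable (dfac L τ k j) := by
  unfold dfac
  split_ifs
  · exact ENNReal.measurable_ofReal.comp ((continuous_dgn L τ).pow 2).measurable
  · exact ENNReal.measurable_ofReal.comp ((contDiff_gn L τ (n := 0)).continuous.pow 2).measurable

/-- Their integrals: `B/A` for `j = k`, `1` otherwise. [folklore] -/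
theorem lintegral_dfac (hL : 0 ≤ L) (hτ : 0 < τ) (hA : 0 < massA L τ) (k j : Fin 3) :
    ∫⁻ t, dfac L τ k j t = if j = k then ENNReal.ofReal (kinB L τ / massA L τ) else 1 := by
  unfold dfac
  split_ifs
  · exact lintegral_dgn_sq hL hτ hA
  · exact lintegral_gn_sq hL hτ hA

/-- The partial derivatives of the mode: `∂ₖU(x) = g̃'(x_k) ∏_{j ≠ k} g̃(x_j)`. [folklore] -/
theorem fderiv_mode (x : Space) (k : Fin 3) :
    fderiv ℝ (mode L τ) x (EuclideanSpace.single k 1) =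
      dgn L τ (x k) * ∏ j ∈ Finset.univ.erase k, gn L τ (x j) := by
  have h : HasFDerivAt (mode L τ) (∑ i, (∏ j ∈ Finset.univ.erase i, gn L τ (x j)) •
      (dgn L τ (x i) • PiLp.proj 2 (fun _ : Fin 3 => ℝ) i)) x :=
    HasFDerivAt.finsetProd fun i _ => by
      have h1 := (hasDerivAt_gn L τ (x i)).comp_hasFDerivAt x
        (PiLp.hasFDerivAt_apply (𝕜 := ℝ) 2 x i)
      exact h1
  rw [h.fderiv]
  simp [PiLp.single_apply, mul_comm]

/-- `|∂ₖU(x)|²` as a product of one-variable factors. [folklore] -/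
theorem ofReal_fderiv_mode_sq (x : Space) (k : Fin 3) :
    ENNReal.ofReal ((fderiv ℝ (mode L τ) x (EuclideanSpace.single k 1)) ^ 2) =
      ∏ j, dfac L τ k j (x j) := by
  rw [fderiv_mode, mul_pow, ← Finset.prod_pow,
    ← Finset.mul_prod_erase Finset.univ (fun j => dfac L τ k j (x j)) (Finset.mem_univ k)]
  simp only [dfac, if_true]
  rw [ENNReal.ofReal_mul (sq_nonneg _), ENNReal.ofReal_prod_of_nonneg (fun j _ => sq_nonneg _)]
  congr 1
  refine Finset.prod_congr rfl fun j hj => ?_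
  rw [if_neg (Finset.ne_of_mem_erase hj)]

/-! ### The trial state -/

/-- **The approximant** `φ(Y) = U(y₀)` as a one-particle Dirichlet trial state of `Λ_L`.
[folklore] -/
def approxState (hL : 0 < L) (hτ : 0 < τ) (hA : 0 < massA L τ) : TrialState 1 L where
  ψ Y := (mode L τ (Y 0) : ℂ)
  contDiff := Complex.ofRealCLM.contDiff.comp ((contDiff_mode L τ).comp (contDiff_apply ℝ Space 0))
  eq_zero Y hY := by
    have h0 : Y 0 ∉ box L := fun h => hY fun i => by
      rw [Subsingleton.elim i 0]; exact h
    simp [mode_eq_zero hτ h0]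
  symm σ Y := by rw [Subsingleton.elim σ 1]; rfl
  norm_eq := by
    have h1 : ∀ x : Space, (‖(mode L τ x : ℂ)‖₊ : ℝ≥0∞) ^ 2 =
        ∏ j, ENNReal.ofReal (gn L τ (x j) ^ 2) := by
      intro x
      rw [← Poincare.ofReal_norm_sq, Complex.norm_real, Real.norm_eq_abs, sq_abs, mode,
        ← Finset.prod_pow, ENNReal.ofReal_prod_of_nonneg fun j _ => sq_nonneg _]
    rw [lintegral_funUnique_comp (fun x => (‖(mode L τ x : ℂ)‖₊ : ℝ≥0∞) ^ 2)]
    simp_rw [h1]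
    rw [lintegral_prod_space (fun _ t => ENNReal.ofReal (gn L τ t ^ 2)) fun _ =>
      ENNReal.measurable_ofReal.comp ((contDiff_gn L τ (n := 0)).continuous.pow 2).measurable]
    simp [lintegral_gn_sq hL.le hτ hA]

/-- The kinetic density of the approximant. [folklore] -/
theorem kineticDensity_approxState (hL : 0 < L) (hτ : 0 < τ) (hA : 0 < massA L τ) (Y : Config 1) :
    kineticDensity (approxState hL hτ hA).ψ Y = ∑ k, ∏ j, dfac L τ k j (Y 0 j) := by
  unfold kineticDensity
  rw [Fin.sum_univ_one]
  refine Finset.sum_congr rfl fun k _ => ?_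
  have hψ : HasFDerivAt (⇑Complex.ofRealCLM ∘ (mode L τ ∘ fun Y : Config 1 => Y 0))
      (Complex.ofRealCLM.comp ((fderiv ℝ (mode L τ) (Y 0)).comp
        (ContinuousLinearMap.proj (R := ℝ) (φ := fun _ : Fin 1 => Space) 0))) Y :=
    Complex.ofRealCLM.hasFDerivAt.comp Y
      ((((contDiff_mode L τ).differentiable (by simp)) (Y 0)).hasFDerivAt.comp Y
        (hasFDerivAt_apply (𝕜 := ℝ) 0 Y))
  have hfun : (approxState hL hτ hA).ψ = ⇑Complex.ofRealCLM ∘ (mode L τ ∘ fun Y : Config 1 => Y 0) :=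
    rfl
  rw [hfun, hψ.fderiv, ContinuousLinearMap.comp_apply, ContinuousLinearMap.comp_apply,
    ContinuousLinearMap.proj_apply, Pi.single_eq_same, Complex.ofRealCLM_apply, Complex.nnnorm_real,
    ← Poincare.ofReal_norm_sq, Real.norm_eq_abs, sq_abs, ofReal_fderiv_mode_sq]

/-- **The energy of the approximant**: `3 B/A`. [folklore] -/
theorem energy_approxState (hL : 0 < L) (hτ : 0 < τ) (hA : 0 < massA L τ) :
    energy 0 (approxState hL hτ hA) = 3 * ENNReal.ofReal (kinB L τ / massA L τ) := by
  unfold energy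
  simp only [interaction_zeroPotential, zero_mul, add_zero, kineticDensity_approxState hL hτ hA]
  rw [lintegral_funUnique_comp (fun x : Space => ∑ k, ∏ j, dfac L τ k j (x j))]
  have hmeas : ∀ k j, Measurable fun x : Space => dfac L τ k j (x j) := fun k j =>
    (measurable_dfac L τ k j).comp
      ((measurable_pi_apply j).comp (PiLp.volume_preserving_ofLp (Fin 3)).measurable)
  rw [lintegral_finsetSum _ fun k _ => Finset.measurable_prod _ fun j _ => hmeas k j]
  simp_rw [lintegral_prod_space (dfac L τ _) (measurable_dfac L τ _), lintegral_dfac hL.le hτ hA,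
    Finset.prod_ite_eq', Finset.mem_univ, if_true, Finset.sum_const, Finset.card_univ,
    Fintype.card_fin, nsmul_eq_mul]
  norm_num

/-! ### The distance to the sine mode -/

/-- The key pointwise inequality behind `‖∏g̃ - ∏s̃‖² ≤ 9 ∫(g̃-s̃)²`:
`(g₀g₁g₂ - s₀s₁s₂)² ≤ 3((g₀-s₀)²g₁²g₂² + s₀²(g₁-s₁)²g₂² + s₀²s₁²(g₂-s₂)²)`. [folklore] -/
theorem prod_sub_prod_sq_le (g₀ g₁ g₂ s₀ s₁ s₂ : ℝ) :
    (g₀ * g₁ * g₂ - s₀ * s₁ * s₂) ^ 2 ≤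
      3 * ((g₀ - s₀) ^ 2 * g₁ ^ 2 * g₂ ^ 2 + s₀ ^ 2 * (g₁ - s₁) ^ 2 * g₂ ^ 2 +
        s₀ ^ 2 * s₁ ^ 2 * (g₂ - s₂) ^ 2) := by
  set p := (g₀ - s₀) * g₁ * g₂
  set q := s₀ * (g₁ - s₁) * g₂
  set r := s₀ * s₁ * (g₂ - s₂)
  have h : g₀ * g₁ * g₂ - s₀ * s₁ * s₂ = p + q + r := by simp only [p, q, r]; ring
  have h1 : (g₀ - s₀) ^ 2 * g₁ ^ 2 * g₂ ^ 2 = p ^ 2 := by simp only [p]; ring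
  have h2 : s₀ ^ 2 * (g₁ - s₁) ^ 2 * g₂ ^ 2 = q ^ 2 := by simp only [q]; ring
  have h3 : s₀ ^ 2 * s₁ ^ 2 * (g₂ - s₂) ^ 2 = r ^ 2 := by simp only [r]; ring
  rw [h, h1, h2, h3]
  nlinarith [sq_nonneg (p - q), sq_nonneg (q - r), sq_nonneg (p - r)]

/-- **The distance of the approximant to the sine mode**:
`‖φ - u_L‖² ≤ 9 (2D/A + 2(1/√A - √(2/L))² L/2)`. [folklore] -/
theorem dist_approxState_le (hL : 0 < L) (hτ : 0 < τ) (hA : 0 < massA L τ) :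
    ∫⁻ Y : Config 1, (‖(approxState hL hτ hA).ψ Y -
        ((Set.indicator (box L)
            (fun x : Space => ∏ k : Fin 3, Real.sqrt (2 / L) * Real.sin (Real.pi * x k / L))
              (Y 0) : ℝ) : ℂ)‖₊ : ℝ≥0∞) ^ 2 ≤
      ENNReal.ofReal (9 * (2 / massA L τ * defD L τ +
        2 * ((Real.sqrt (massA L τ))⁻¹ - Real.sqrt (2 / L)) ^ 2 * (L / 2))) := by
  set u : Space → ℝ := fun x => ∏ k : Fin 3, Real.sqrt (2 / L) * Real.sin (Real.pi * x k / L)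
    with hu
  set P : ℝ → ℝ≥0∞ := fun t => ENNReal.ofReal (gn L τ t ^ 2) with hP
  set Q : ℝ → ℝ≥0∞ := (Ioo 0 L).indicator fun t => ENNReal.ofReal (sn L t ^ 2) with hQ
  set R : ℝ → ℝ≥0∞ := (Ioo 0 L).indicator fun t => ENNReal.ofReal ((gn L τ t - sn L t) ^ 2) with hR
  have hPm : Measurable P :=
    ENNReal.measurable_ofReal.comp ((contDiff_gn L τ (n := 0)).continuous.pow 2).measurable
  have hQm : Measurable Q :=
    (ENNReal.measurable_ofReal.comp ((continuous_sn L).pow 2).measurable).indicator measurableSet_Ioo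
  have hRm : Measurable R :=
    (ENNReal.measurable_ofReal.comp ((by
      have := (contDiff_gn L τ (n := 0)).continuous; have := continuous_sn L; fun_prop :
        Continuous fun t => (gn L τ t - sn L t) ^ 2)).measurable).indicator measurableSet_Ioo
  -- the pointwise bound
  have hpt : ∀ x : Space, (‖(mode L τ x : ℂ) - ((Set.indicator (box L) u x : ℝ) : ℂ)‖₊ : ℝ≥0∞) ^ 2 ≤
      3 * (R (x 0) * P (x 1) * P (x 2) + Q (x 0) * R (x 1) * P (x 2) +
        Q (x 0) * Q (x 1) * R (x 2)) := by
    intro x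
    by_cases hx : x ∈ box L
    · have hxk : ∀ k, x k ∈ Ioo 0 L := hx
      rw [indicator_of_mem hx, ← Complex.ofReal_sub, ← Poincare.ofReal_norm_sq, Complex.norm_real,
        Real.norm_eq_abs, sq_abs]
      simp only [hP, hQ, hR, indicator_of_mem (hxk _)]
      rw [← ENNReal.ofReal_mul (sq_nonneg _), ← ENNReal.ofReal_mul (by positivity),
        ← ENNReal.ofReal_mul (sq_nonneg _), ← ENNReal.ofReal_mul (by positivity),
        ← ENNReal.ofReal_mul (sq_nonneg _), ← ENNReal.ofReal_mul (by positivity),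
        ← ENNReal.ofReal_add (by positivity) (by positivity),
        ← ENNReal.ofReal_add (by positivity) (by positivity), ← ENNReal.ofReal_ofNat,
        ← ENNReal.ofReal_mul (by norm_num)]
      refine ENNReal.ofReal_le_ofReal ?_
      simp only [mode, hu, Fin.prod_univ_three, sn]
      exact prod_sub_prod_sq_le _ _ _ _ _ _
    · rw [indicator_of_notMem hx, mode_eq_zero hτ hx]
      simp
  -- integrate
  have hI : ∫⁻ x : Space, 3 * (R (x 0) * P (x 1) * P (x 2) + Q (x 0) * R (x 1) * P (x 2) +
      Q (x 0) * Q (x 1) * R (x 2)) =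
        3 * ((∫⁻ t, R t) * (∫⁻ t, P t) * (∫⁻ t, P t) + (∫⁻ t, Q t) * (∫⁻ t, R t) * (∫⁻ t, P t) +
          (∫⁻ t, Q t) * (∫⁻ t, Q t) * (∫⁻ t, R t)) := by
    have hc : ∀ {F : ℝ → ℝ≥0∞}, Measurable F → ∀ j : Fin 3, Measurable fun x : Space => F (x j) :=
      fun hF j => hF.comp ((measurable_pi_apply j).comp
        (PiLp.volume_preserving_ofLp (Fin 3)).measurable)
    have hm1 : Measurable fun x : Space => R (x 0) * P (x 1) * P (x 2) :=
      ((hc hRm 0).mul (hc hPm 1)).mul (hc hPm 2)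
    have hm2 : Measurable fun x : Space => Q (x 0) * R (x 1) * P (x 2) :=
      ((hc hQm 0).mul (hc hRm 1)).mul (hc hPm 2)
    have hm3 : Measurable fun x : Space => Q (x 0) * Q (x 1) * R (x 2) :=
      ((hc hQm 0).mul (hc hQm 1)).mul (hc hRm 2)
    have hm12 : Measurable fun x : Space =>
        R (x 0) * P (x 1) * P (x 2) + Q (x 0) * R (x 1) * P (x 2) := hm1.add hm2
    have hm123 : Measurable fun x : Space =>
        R (x 0) * P (x 1) * P (x 2) + Q (x 0) * R (x 1) * P (x 2) + Q (x 0) * Q (x 1) * R (x 2) :=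
      hm12.add hm3
    rw [lintegral_const_mul _ hm123, lintegral_add_left hm12, lintegral_add_left hm1,
      lintegral_mul_three_space R P P hRm hPm hPm, lintegral_mul_three_space Q R P hQm hRm hPm,
      lintegral_mul_three_space Q Q R hQm hQm hRm]
  have hD0 : 0 ≤ defD L τ := intervalIntegral.integral_nonneg hL.le fun t _ => sq_nonneg _
  have hP1 : ∫⁻ t, P t = 1 := lintegral_gn_sq hL.le hτ hA
  have hQ1 : ∫⁻ t, Q t = 1 := lintegral_indicator_sn_sq hL
  have hR1 := lintegral_indicator_gn_sub_sn_sq_le (τ := τ) hL hA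
  calc ∫⁻ Y : Config 1, (‖(approxState hL hτ hA).ψ Y - ((Set.indicator (box L) u (Y 0) : ℝ) : ℂ)‖₊ :
        ℝ≥0∞) ^ 2
      = ∫⁻ x : Space, (‖(mode L τ x : ℂ) - ((Set.indicator (box L) u x : ℝ) : ℂ)‖₊ : ℝ≥0∞) ^ 2 :=
        lintegral_funUnique_comp
          (fun x : Space => (‖(mode L τ x : ℂ) - ((Set.indicator (box L) u x : ℝ) : ℂ)‖₊ : ℝ≥0∞) ^ 2)
    _ ≤ _ := lintegral_mono hpt
    _ = _ := hI
    _ ≤ 3 * (ENNReal.ofReal (2 / massA L τ * defD L τ +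
          2 * ((Real.sqrt (massA L τ))⁻¹ - Real.sqrt (2 / L)) ^ 2 * (L / 2)) * 1 * 1 +
          1 * ENNReal.ofReal (2 / massA L τ * defD L τ +
          2 * ((Real.sqrt (massA L τ))⁻¹ - Real.sqrt (2 / L)) ^ 2 * (L / 2)) * 1 +
          1 * 1 * ENNReal.ofReal (2 / massA L τ * defD L τ +
          2 * ((Real.sqrt (massA L τ))⁻¹ - Real.sqrt (2 / L)) ^ 2 * (L / 2))) := by
        rw [hP1, hQ1]; gcongr
    _ = _ := by
        rw [mul_one, mul_one, one_mul, mul_one, one_mul, one_mul, ← ENNReal.ofReal_add (by positivity)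
          (by positivity), ← ENNReal.ofReal_add (by positivity) (by positivity),
          ← ENNReal.ofReal_ofNat, ← ENNReal.ofReal_mul (by norm_num)]
        congr 1
        ring

end FreeOneBodyApprox

open FreeOneBodyApprox

/-- **Stub S2a — free one-body approximants of the sine mode.** For every `L > 0` and `ε > 0`
there is a one-particle `C¹` Dirichlet state of `Λ_L` with free energy `≤ 3(π/L)² + ε` and
`L²`-distance² `≤ ε` from the normalised sine mode `u_L(x) = ∏ₖ √(2/L) sin(π xₖ/L)` (extended by
zero off the box): the normalised products `∏ₖ g̃_τ(x_k)` of the cut-off sines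
`sin(πt/L) S(t/τ) S((L-t)/τ)` (`S = Real.smoothTransition`) for `τ` small. [folklore] -/
theorem stub_freeOneBodyApprox :
    ∀ (L : ℝ), 0 < L → ∀ ε : ℝ, 0 < ε → ∃ φ : TrialState 1 L,
      energy 0 φ ≤ ENNReal.ofReal (3 * (Real.pi / L) ^ 2 + ε) ∧
      ∫⁻ Y : Config 1, (‖φ.ψ Y -
          ((Set.indicator (box L)
              (fun x : Space => ∏ k : Fin 3, Real.sqrt (2 / L) * Real.sin (Real.pi * x k / L)) (Y 0) : ℝ) : ℂ)‖₊ : ℝ≥0∞) ^ 2 ≤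
        ENNReal.ofReal ε := by
  intro L hL ε hε
  obtain ⟨C, hC0, hC1⟩ := exists_bound_deriv_smoothTransition
  have hC : ∀ y, |deriv Real.smoothTransition y| ≤ C := fun y => by
    rcases le_or_gt y 0 with hy | hy
    · rw [deriv_smoothTransition_of_nonpos hy, abs_zero]; exact hC0
    rcases le_or_gt 1 y with hy1 | hy1
    · rw [deriv_smoothTransition_of_one_le hy1, abs_zero]; exact hC0
    · exact hC1 y ⟨hy.le, hy1.le⟩
  set K : ℝ := Real.pi / L * (1 + 2 * C) with hK
  -- `A(τ) → L/2` as `τ → 0⁺`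
  have hev : ∀ᶠ τ in 𝓝[>] (0 : ℝ), τ ∈ Ioo 0 (L / 2) := Ioo_mem_nhdsGT (by positivity)
  have ha : Tendsto (fun τ => L / 2 - τ + L / Real.pi * Real.sin (Real.pi / L * τ) *
      Real.cos (Real.pi / L * τ)) (𝓝[>] 0) (𝓝 (L / 2)) := by
    have hc : Continuous fun τ => L / 2 - τ + L / Real.pi * Real.sin (Real.pi / L * τ) *
        Real.cos (Real.pi / L * τ) := by fun_prop
    have := hc.tendsto 0
    simp only [mul_zero, Real.sin_zero, sub_zero, zero_mul, add_zero] at this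
    exact this.mono_left nhdsWithin_le_nhds
  have hA : Tendsto (massA L) (𝓝[>] 0) (𝓝 (L / 2)) :=
    tendsto_of_tendsto_of_tendsto_of_le_of_le' ha tendsto_const_nhds
      (hev.mono fun τ hτ => le_massA hL hτ.1 hτ.2.le) (Eventually.of_forall fun τ => massA_le hL τ)
  have hL2 : (L / 2 : ℝ) ≠ 0 := by positivity
  -- the energy bound `3 ((π/L)² L/2 + 2τK²)/A(τ) → 3 (π/L)²`
  have hb : Tendsto (fun τ => 3 * (((Real.pi / L) ^ 2 * (L / 2) + 2 * τ * K ^ 2) / massA L τ))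
      (𝓝[>] 0) (𝓝 (3 * (Real.pi / L) ^ 2)) := by
    have hnum : Tendsto (fun τ : ℝ => (Real.pi / L) ^ 2 * (L / 2) + 2 * τ * K ^ 2) (𝓝[>] 0)
        (𝓝 ((Real.pi / L) ^ 2 * (L / 2) + 2 * 0 * K ^ 2)) :=
      ((by fun_prop : Continuous fun τ : ℝ => (Real.pi / L) ^ 2 * (L / 2) + 2 * τ * K ^ 2).tendsto
        0).mono_left nhdsWithin_le_nhds
    have h := (hnum.div hA hL2).const_mul 3
    have he : 3 * (((Real.pi / L) ^ 2 * (L / 2) + 2 * 0 * K ^ 2) / (L / 2)) =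
        3 * (Real.pi / L) ^ 2 := by
      rw [mul_zero, zero_mul, add_zero]; field_simp
    rwa [he] at h
  -- the distance bound `9 (2·2τ/A + 2 (1/√A - √(2/L))² L/2) → 0`
  have hd : Tendsto (fun τ => 9 * (2 / massA L τ * (2 * τ) +
      2 * ((Real.sqrt (massA L τ))⁻¹ - Real.sqrt (2 / L)) ^ 2 * (L / 2))) (𝓝[>] 0) (𝓝 0) := by
    have h2τ : Tendsto (fun τ : ℝ => 2 * τ) (𝓝[>] 0) (𝓝 (2 * 0)) :=
      ((by fun_prop : Continuous fun τ : ℝ => 2 * τ).tendsto 0).mono_left nhdsWithin_le_nhds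
    have hsq : Tendsto (fun τ => (Real.sqrt (massA L τ))⁻¹) (𝓝[>] 0) (𝓝 (Real.sqrt (L / 2))⁻¹) :=
      ((Real.continuous_sqrt.tendsto _).comp hA).inv₀ (Real.sqrt_pos.2 (by positivity)).ne'
    have h := (((tendsto_const_nhds (x := (2 : ℝ))).div hA hL2).mul h2τ).add
      (((hsq.sub_const (Real.sqrt (2 / L))).pow 2).const_mul 2 |>.mul_const (L / 2)) |>.const_mul 9
    have he : 9 * (2 / (L / 2) * (2 * 0) + 2 * ((Real.sqrt (L / 2))⁻¹ - Real.sqrt (2 / L)) ^ 2 * (L / 2)) =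
        0 := by
      rw [← Real.sqrt_inv, inv_div, sub_self]; ring
    rwa [he] at h
  -- extract a good `τ`
  have h1 := hb.eventually_lt_const (v := 3 * (Real.pi / L) ^ 2) (u := 3 * (Real.pi / L) ^ 2 + ε)
    (by linarith)
  have h2 := hd.eventually_lt_const hε
  have h3 := hA.eventually_const_lt (u := L / 4) (by linarith)
  obtain ⟨τ, hτI, hb1, hd1, hA1⟩ := (hev.and (h1.and (h2.and h3))).exists
  have hτ : 0 < τ := hτI.1
  have hA0 : 0 < massA L τ := by linarith
  refine ⟨approxState hL hτ hA0, ?_, ?_⟩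
  · rw [energy_approxState hL hτ hA0, ← ENNReal.ofReal_ofNat, ← ENNReal.ofReal_mul (by norm_num)]
    refine ENNReal.ofReal_le_ofReal (le_trans ?_ hb1.le)
    gcongr
    exact kinB_le hL hτ hτI.2.le hC
  · refine (dist_approxState_le hL hτ hA0).trans (ENNReal.ofReal_le_ofReal (le_trans ?_ hd1.le))
    gcongr
    exact defD_le hτ hτI.2.le

end Summit.AtomisticToContinuum.BoseEinsteinCondensation.CoupledBaths

end
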